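import Literature.IUT.HodgeArakelov.CommutatorPairingDescent
import Literature.IUT.HodgeArakelov.CoreTowerFlPMQuotient
import Literature.AnabelianGeometry.EtaleTheta.Thm16SubdagCompanion
import HarnessLib

/-!
# [IUTchII] Rmk. 1.1.1 (iv): the CONJUGATION ACTIONS of `Π_C(M) = Π^tp_C` on `(l·ℤ)(M) = Δ_X(M)/Δ_Y(M)` and on
# `Δ^ell_Y(M)` at the genuine [EtTh] frame — constructed and pinned (GAP row G-w4d018-1, part 3)

Mochizuki, *Inter-universal Teichmüller theory II*, §1, Remark 1.1.1 (iv), kurims manuscript (Dec. 2020) p. 23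
l. 41–49 [claim: Mochizuki2012, status: disputed] (IUTchII §1 Rmk 1.1.1 (iv), kurims p.23): «one may regard the
commutator map of (iii) as a map `[-,-] : (Δ_X(M^Θ)/Δ_Y(M^Θ)) × Δ^ell_Y(M^Θ) → Π_{M^Θ}|_{(l·Δ_Θ)(M^Θ)}` for which both
the domain and the codomain are equipped with natural actions by `Π_C(M^Θ)`» (the actions on the domain: «via the
natural isomorphisms `Δ_X(M^Θ)/Δ_Y(M^Θ) ⥲ Δ_X(M)/Δ_Y(M)`, `Δ^ell_Y(M^Θ) ⥲ Δ^ell_Y(M)`» with the `Π_C`-stable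
subquotients of the unprimed tower, l. 35–40); [EtTh] §2 p. 36 («`ι ∈ Δ_C` … "multiplication by `−1`"», the `Z`-sign)
[cite: MochizukiEtTh2009, Def 2.1 p.36].

abc-iut cell, layer L6, seat abc-iut-w4-d035 (gen 11), GAP-LEDGER row **G-w4d018-1** (node IUTchII:Rmk1.1.1(iv)
(iv)-C), sequel of `CommutatorPairingDescent` (lemma (i) «`(Δ^tp_{Y̲̲})^ell = (Δ^tp_Y)^ell`»). PROOF-ONLY (0 `def`).
At the [EtTh] model frame (abc-iut-L6-d6's `F.reconstruction e` of a mono-theta environment identified with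
abc-iut-L2-t8's `C.rigidData μ hC hS h15 L`; `Π_X(M) = Π^tp_{X̲̲}`, `Π_Y(M) = Π^tp_{Y̲̲}`, `Δ_Y(M) = Δ^tp_{Y̲̲}`) over
abc-iut-L2-d3's C-level record `cl` (`conjX c` = inner automorphism of `Π^tp_C` restricted to `Π^tp_X`; `Π^tp_{X̲̲}`
is NOT normal in `Π^tp_C`, so the actions are READ BACK through `toZ` and `(Π^tp_X)^ell`):

* **`ModelFrame.exists_conjActlZ`** — `actlZ : Π^tp_C →* MulAut ((l·ℤ)(M))`, the typed field `FlSymmetry.actlZ` FOR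
  CONJUGATION: pinned by «`[x′] = actlZ c [x] ⇒ toZ x′ = toZ (c x c⁻¹)`» (the embedding `(l·ℤ)(M) = Π^tp_{X̲̲}/Π^tp_{Y̲̲}
  ↪ Π^tp_X/Π^tp_Y = Z`); explicitly `actlZ c = 1` for `c ∈ Π^tp_X` and `actlZ c = (·)⁻¹` otherwise (abc-iut-w4-d019's
  `toZ_conjX_of_(not_)mem_range`, the (R1c) clause `hR1c` «the inversion acts by `−1` on `Z`» as binder);
* **`ModelFrame.exists_conjActEll`** — for every core tower `W` with `Ker(Π_Y(M) ↠ Π^ell_Y(M)) = Ker(Π^tp_X ↠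
  (Π^tp_X)^ell) ∩ Π^tp_{Y̲̲}` (abc-iut-w5-d225's `hWker`), `actEll : Π^tp_C →* MulAut (Δ^ell_Y(M))`, the typed field
  `FlSymmetry.actEll` FOR CONJUGATION: pinned by «`[b′] = actEll c [b] ⇒ b′ ≡ c b c⁻¹` in `(Π^tp_X)^ell`» — conjugation
  on `Δ^tp_Y` descends to `(Δ^tp_Y)^ell = Δ^tp_Y/(Δ^tp_Y ∩ Ker((Π^tp_X) ↠ (Π^tp_X)^ell))` (`Thm16Sub.map_ker_toEll_eq`,
  `map_deltaTemp_conjX`, `hR1c` for `Π^tp_Y`) and `Δ^ell_Y(M) ⥲ (Δ^tp_Y)^ell` is BIJECTIVE (injective by `hWker`,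
  surjective = lemma (i) `exists_mem_Huu_dtpY_thetaToEll_eq`, inputs `IsEtThOrigin`, `hYcl`, `hker`, `l` prime).
BINDER CENSUS (BY NAME): `cl`, `hR1c`, `IsEtThOrigin`, `hYcl`, `hker`, `l` prime, `hWker`; no `Prop` fact introduced,
no FACT-LIST row consumed. HONEST FRAMING: kernel facts about the cell's own interfaces and model; Rmk. 1.1.1 is outside
the [IUTchIII] Cor. 3.12 cone; no side taken on Cor. 3.12; typed ≠ proved; constructed ≠ endorsed.
-/

noncomputable section

namespace Literature.IUT.HodgeArakelov

open Literature.AnabelianGeometry.EtaleTheta Literature.AnabelianGeometry.SemiGraphs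
open scoped Literature.AnabelianGeometry.EtaleTheta

namespace ModelFrame

variable {p : ℕ} [Fact p.Prime] {Mt : MuTwoSetting p}
  {E : Mt.toThetaSetting.EtaleThetaData} {l : ℕ} (C : E.DoubleUnderline l)
  {S : ThetaSetting.{0}} (μ : Mt.toThetaSetting.CyclotomeMod l S.N)
  (hC : Mt.toThetaSetting.Compat) (hS : Mt.toThetaSetting.Sec2Hyps)
  (h15 : ThetaSetting.Prop15iii E hC) (L : C.CuspLabels)
  (F : ModelFrame S (C.rigidData μ hC hS h15 L)) {Menv : MonoThetaEnv S}
  (e : Menv.Pi ≃ₜ* (C.rigidData μ hC hS h15 L).env) (cl : Mt.CLevelData)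

/-! ## The action on `(l·ℤ)(M) = Π_X(M)/Π_Y(M) = Π^tp_{X̲̲}/Π^tp_{Y̲̲}` -/

/-- **IUTchII:Rmk1.1.1(iv) — the conjugation action of `Π^tp_C` on `(l·ℤ)(M) = Δ_X(M)/Δ_Y(M)`**, CONSTRUCTED and
PINNED through `toZ : Π^tp_X ↠ Z`: `actlZ c` is the identity for `c ∈ Π^tp_X` and the inversion otherwise (the `ℤ/2`
quotient `Π^tp_C/Π^tp_X`, under the (R1c) clause), and `[x′] = actlZ c [x]` forces `toZ x′ = toZ (conjX c x)`.
[claim: Mochizuki2012, status: disputed] (IUTchII §1 Rmk 1.1.1 (iv), kurims p.23) -/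
theorem exists_conjActlZ (hR1c : ∀ x : Mt.PiTemp, Mt.toZ (cl.conjX Mt.epsPM x) = (Mt.toZ x)⁻¹) :
    ∃ actlZ : Mt.GtpC →* MulAut (F.reconstruction e).lZ,
      (∀ (c : Mt.GtpC) (x x' : ↥C.Huu),
          (QuotientGroup.mk x' : ↥C.Huu ⧸ (F.reconstruction e).inclY.range) =
            actlZ c (QuotientGroup.mk x : ↥C.Huu ⧸ (F.reconstruction e).inclY.range) →
          Mt.toZ (x' : Mt.PiTemp) = Mt.toZ (cl.conjX c (x : Mt.PiTemp))) ∧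
      (∀ c : Mt.GtpC, c ∈ Mt.inclX.range → actlZ c = 1) ∧
      (∀ c : Mt.GtpC, c ∉ Mt.inclX.range → ∀ a : (F.reconstruction e).lZ, actlZ c a = a⁻¹) := by
  classical
  haveI hinclYn : (F.reconstruction e).inclY.range.Normal := (F.reconstruction e).inclY_normal
  obtain ⟨ψ⟩ := ModelFrame.nonempty_lZ_mulEquiv_int F e
  have hcomm : ∀ a b : (F.reconstruction e).lZ, a * b = b * a := fun a b =>
    ψ.injective (by rw [map_mul, map_mul, mul_comm])
  -- the inversion of the abelian group `(l·ℤ)(M)` as an automorphism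
  let ι : MulAut (F.reconstruction e).lZ :=
    { toFun := fun a => a⁻¹, invFun := fun a => a⁻¹, left_inv := fun a => inv_inv a, right_inv := fun a => inv_inv a
      map_mul' := fun a b => by rw [mul_inv_rev, hcomm] }
  have hιι : ι * ι = 1 := by
    apply MulEquiv.ext; intro a; change (a⁻¹)⁻¹ = a; exact inv_inv a
  have h2 := Mt.index_range_inclX
  refine ⟨{ toFun := fun c => if c ∈ Mt.inclX.range then 1 else ι
            map_one' := by rw [if_pos (one_mem _)]
            map_mul' := fun c c' => ?_ }, ?_, ?_, ?_⟩
  · -- multiplicativity: `Π^tp_X` has index `2` in `Π^tp_C`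
    by_cases hc : c ∈ Mt.inclX.range <;> by_cases hc' : c' ∈ Mt.inclX.range
    · rw [if_pos (mul_mem hc hc'), if_pos hc, if_pos hc', one_mul]
    · have : c * c' ∉ Mt.inclX.range := fun h => hc' (((Subgroup.mul_mem_iff_of_index_two h2).1 h).1 hc)
      rw [if_neg this, if_pos hc, if_neg hc', one_mul]
    · have : c * c' ∉ Mt.inclX.range := fun h => hc (((Subgroup.mul_mem_iff_of_index_two h2).1 h).2 hc')
      rw [if_neg this, if_neg hc, if_pos hc', mul_one]
    · have : c * c' ∈ Mt.inclX.range := by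
        rw [Subgroup.mul_mem_iff_of_index_two h2]
        exact ⟨fun h => absurd h hc, fun h => absurd h hc'⟩
      rw [if_pos this, if_neg hc, if_neg hc', hιι]
  · -- the pin through `toZ`
    intro c x x' hxx'
    change _ = (if c ∈ Mt.inclX.range then (1 : MulAut (F.reconstruction e).lZ) else ι) _ at hxx'
    by_cases hc : c ∈ Mt.inclX.range
    · rw [if_pos hc, MulAut.one_apply] at hxx'
      have hxx'' : (QuotientGroup.mk x' : ↥C.Huu ⧸ (F.reconstruction e).inclY.range) = QuotientGroup.mk x := hxx'
      rw [QuotientGroup.eq] at hxx''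
      obtain ⟨δ, hδ⟩ := hxx''
      have hδY : ((δ : ↥C.Huu) : Mt.PiTemp) ∈ Mt.GtpY := Subgroup.mem_subgroupOf.1 δ.2
      have hδ' : (δ : ↥C.Huu) = x'⁻¹ * x := hδ
      rw [cl.toZ_conjX_of_mem_range hc]
      have h1 : Mt.toZ (((x'⁻¹ * x : ↥C.Huu)) : Mt.PiTemp) = 1 := by rw [← hδ']; exact hδY
      rw [Subgroup.coe_mul, Subgroup.coe_inv, map_mul, map_inv, inv_mul_eq_one] at h1
      exact h1
    · rw [if_neg hc] at hxx'
      have hxx'' : (QuotientGroup.mk x' : ↥C.Huu ⧸ (F.reconstruction e).inclY.range) = QuotientGroup.mk x⁻¹ :=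
        hxx'
      rw [QuotientGroup.eq] at hxx''
      obtain ⟨δ, hδ⟩ := hxx''
      have hδY : ((δ : ↥C.Huu) : Mt.PiTemp) ∈ Mt.GtpY := Subgroup.mem_subgroupOf.1 δ.2
      have hδ' : (δ : ↥C.Huu) = x'⁻¹ * x⁻¹ := hδ
      rw [cl.toZ_conjX_of_not_mem_range hR1c hc]
      have h1 : Mt.toZ (((x'⁻¹ * x⁻¹ : ↥C.Huu)) : Mt.PiTemp) = 1 := by rw [← hδ']; exact hδY
      rw [Subgroup.coe_mul, Subgroup.coe_inv, Subgroup.coe_inv, map_mul, map_inv, map_inv,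
        inv_mul_eq_one] at h1
      exact h1
  · intro c hc
    change (if c ∈ Mt.inclX.range then (1 : MulAut (F.reconstruction e).lZ) else ι) = 1
    rw [if_pos hc]
  · intro c hc a
    change (if c ∈ Mt.inclX.range then (1 : MulAut (F.reconstruction e).lZ) else ι) a = a⁻¹
    rw [if_neg hc]
    rfl

/-! ## The action on `Δ^ell_Y(M) = Δ_Y(M)/(Δ_Y(M) ∩ Ker(Π_Y ↠ Π^ell_Y))` -/

/-- **IUTchII:Rmk1.1.1(iv) — the conjugation action of `Π^tp_C` on `Δ^ell_Y(M)`**, CONSTRUCTED and PINNED through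
`(Π^tp_X)^ell`: conjugation on `Δ^tp_Y` descends to `(Δ^tp_Y)^ell` (the kernel of `Π^tp_X ↠ (Π^tp_X)^ell` and `Δ^tp_Y`
are `conjX`-stable), and `Δ^ell_Y(M) = Δ^tp_{Y̲̲}/(…) ⥲ (Δ^tp_Y)^ell` is bijective (lemma (i) of
`CommutatorPairingDescent`); `[b′] = actEll c [b]` forces `b′ ≡ conjX c b` modulo `Ker(Π^tp_X ↠ (Π^tp_X)^ell)`.
Inputs BY NAME: `hR1c`, `IsEtThOrigin`, `hYcl`, `hker`, `l` prime, `hWker`.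
[claim: Mochizuki2012, status: disputed] (IUTchII §1 Rmk 1.1.1 (iv), kurims p.23) -/
theorem exists_conjActEll (hR1c : ∀ x : Mt.PiTemp, Mt.toZ (cl.conjX Mt.epsPM x) = (Mt.toZ x)⁻¹)
    (hO : Mt.toThetaSetting.IsEtThOrigin)
    (hYcl : (Mt.DtpY.map Mt.toHat.toMonoidHom).topologicalClosure ≤
      Mt.DtpY.map Mt.toHat.toMonoidHom ⊔ (⁅⁅Mt.DeltaHat, Mt.DeltaHat⁆, Mt.DeltaHat⁆).topologicalClosure)
    (hker : Mt.toTheta.ker ≤ C.Huu) (hl : l.Prime) (W : CoreTower (F.reconstruction e))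
    [hWn : (W.kerEll.subgroupOf (F.reconstruction e).DeltaY).Normal]
    (hWker : W.kerEll = ((Mt.thetaToEll.comp Mt.toTheta).ker).comap
      (C.Huu.subtype.comp (Mt.GtpY.subgroupOf C.Huu).subtype)) :
    ∃ actEll : Mt.GtpC →* MulAut W.DeltaYell,
      ∀ (c : Mt.GtpC) (b b' : ↥(F.reconstruction e).DeltaY),
        (QuotientGroup.mk b' : W.DeltaYell) = actEll c (QuotientGroup.mk b) →
        Mt.thetaToEll (Mt.toTheta (((b' : ↥(Mt.GtpY.subgroupOf C.Huu)) : ↥C.Huu) : Mt.PiTemp)) =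
          Mt.thetaToEll (Mt.toTheta (cl.conjX c (((b : ↥(Mt.GtpY.subgroupOf C.Huu)) : ↥C.Huu) : Mt.PiTemp))) := by
  classical
  haveI hkerElln : W.kerEll.Normal := W.kerEll_normal
  -- ### notation: `K₀ = Ker(Π^tp_X ↠ (Π^tp_X)^ell)`, `A = Δ^tp_Y`, `Q = A/(A ∩ K₀) = (Δ^tp_Y)^ell`
  set K₀ : Subgroup Mt.PiTemp := (Mt.thetaToEll.comp Mt.toTheta).ker with hK₀
  haveI hK₀n : K₀.Normal := MonoidHom.normal_ker _
  set N : Subgroup ↥Mt.DtpY := K₀.subgroupOf Mt.DtpY with hN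
  haveI hNn : N.Normal := inferInstance
  have hΔY : ∀ y : ↥(F.reconstruction e).DeltaY,
      Mt.aug (((y : ↥(Mt.GtpY.subgroupOf C.Huu)) : ↥C.Huu) : Mt.PiTemp) = 1 := fun y =>
    (mem_deltaY_reconstruction_iff C μ hC hS h15 L F e y.1).1 y.2
  -- ### conjugation preserves `Δ^tp_Y` and `K₀`
  have hGtpY : ∀ (c : Mt.GtpC) (y : Mt.PiTemp), y ∈ Mt.GtpY → cl.conjX c y ∈ Mt.GtpY := by
    intro c y hy
    change Mt.toZ (cl.conjX c y) = 1
    have hy1 : Mt.toZ y = 1 := hy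
    by_cases hc : c ∈ Mt.inclX.range
    · rw [cl.toZ_conjX_of_mem_range hc, hy1]
    · rw [cl.toZ_conjX_of_not_mem_range hR1c hc, hy1, inv_one]
  have hDtpY : ∀ (c : Mt.GtpC) (y : Mt.PiTemp), y ∈ Mt.DtpY → cl.conjX c y ∈ Mt.DtpY := fun c y hy =>
    ⟨hGtpY c y hy.1, (cl.conjX_mem_deltaTemp_iff c y).2 hy.2⟩
  have hK₀st : ∀ (c : Mt.GtpC) (y : Mt.PiTemp), y ∈ K₀ → cl.conjX c y ∈ K₀ := by
    intro c y hy
    have h : cl.conjX c y ∈ K₀.map (cl.conjX c).toMulEquiv.toMonoidHom := ⟨y, hy, rfl⟩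
    rwa [hK₀, Thm16Sub.map_ker_toEll_eq Mt.toThetaSetting Mt.toThetaSetting (cl.conjX c)
      (cl.map_deltaTemp_conjX c)] at h
  -- ### the restricted automorphisms `φ c : Δ^tp_Y →* Δ^tp_Y` and their descent to `Q`
  let φ : Mt.GtpC → (↥Mt.DtpY →* ↥Mt.DtpY) := fun c =>
    ((cl.conjX c).toMulEquiv.toMonoidHom.comp Mt.DtpY.subtype).codRestrict Mt.DtpY
      (fun y => hDtpY c y.1 y.2)
  have hφ_val : ∀ c (y : ↥Mt.DtpY), ((φ c y : ↥Mt.DtpY) : Mt.PiTemp) = cl.conjX c (y : Mt.PiTemp) :=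
    fun _ _ => rfl
  have hφN : ∀ c, N ≤ N.comap (φ c) := by
    intro c y hy
    rw [Subgroup.mem_comap, hN, Subgroup.mem_subgroupOf, hφ_val]
    exact hK₀st c _ (Subgroup.mem_subgroupOf.1 hy)
  let ψ₀ : Mt.GtpC → (↥Mt.DtpY ⧸ N →* ↥Mt.DtpY ⧸ N) := fun c => QuotientGroup.map N N (φ c) (hφN c)
  have hψ₀_mk : ∀ c (y : ↥Mt.DtpY), ψ₀ c (QuotientGroup.mk y) = QuotientGroup.mk (φ c y) := fun _ _ => rfl
  have hφ_mul : ∀ c c' (y : ↥Mt.DtpY), φ (c * c') y = φ c (φ c' y) := fun c c' y =>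
    Subtype.ext (by rw [hφ_val, hφ_val, hφ_val, cl.conjX_mul])
  have hφ_one : ∀ y : ↥Mt.DtpY, φ 1 y = y := fun y => Subtype.ext (by rw [hφ_val, cl.conjX_one])
  have hψ₀_mul : ∀ c c', ψ₀ (c * c') = (ψ₀ c).comp (ψ₀ c') := by
    intro c c'
    apply MonoidHom.ext; intro q
    induction q using QuotientGroup.induction_on with
    | H y => rw [MonoidHom.comp_apply, hψ₀_mk, hψ₀_mk, hψ₀_mk, hφ_mul]
  have hψ₀_one : ψ₀ 1 = MonoidHom.id _ := by
    apply MonoidHom.ext; intro q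
    induction q using QuotientGroup.induction_on with
    | H y => rw [MonoidHom.id_apply, hψ₀_mk, hφ_one]
  have hinv₁ : ∀ c, (ψ₀ c⁻¹).comp (ψ₀ c) = MonoidHom.id _ := fun c => by
    rw [← hψ₀_mul, inv_mul_cancel, hψ₀_one]
  have hinv₂ : ∀ c, (ψ₀ c).comp (ψ₀ c⁻¹) = MonoidHom.id _ := fun c => by
    rw [← hψ₀_mul, mul_inv_cancel, hψ₀_one]
  let ψA : Mt.GtpC → MulAut (↥Mt.DtpY ⧸ N) := fun c =>
    MonoidHom.toMulEquiv (ψ₀ c) (ψ₀ c⁻¹) (hinv₁ c) (hinv₂ c)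
  have hψA : ∀ c q, ψA c q = ψ₀ c q := fun _ _ => rfl
  let ψ : Mt.GtpC →* MulAut (↥Mt.DtpY ⧸ N) :=
    { toFun := ψA
      map_one' := by
        apply MulEquiv.ext; intro q; rw [hψA, hψ₀_one, MulAut.one_apply, MonoidHom.id_apply]
      map_mul' := fun c c' => by
        apply MulEquiv.ext; intro q
        rw [MulAut.mul_apply, hψA, hψA, hψA, hψ₀_mul, MonoidHom.comp_apply] }
  have hψ_mk : ∀ c (y : ↥Mt.DtpY), ψ c (QuotientGroup.mk y) = QuotientGroup.mk (φ c y) := fun _ _ => rfl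
  -- ### `Δ^ell_Y(M) ⥲ Q`: the map induced by `Δ_Y(M) = Δ^tp_{Y̲̲} ⊆ Δ^tp_Y`
  let j₀ : ↥(F.reconstruction e).DeltaY →* ↥Mt.DtpY :=
    { toFun := fun b => ⟨(((b : ↥(Mt.GtpY.subgroupOf C.Huu)) : ↥C.Huu) : Mt.PiTemp),
        ⟨Subgroup.mem_subgroupOf.1 (b : ↥(Mt.GtpY.subgroupOf C.Huu)).2, hΔY b⟩⟩
      map_one' := rfl
      map_mul' := fun _ _ => rfl }
  have hj₀_val : ∀ b : ↥(F.reconstruction e).DeltaY,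
      ((j₀ b : ↥Mt.DtpY) : Mt.PiTemp) = (((b : ↥(Mt.GtpY.subgroupOf C.Huu)) : ↥C.Huu) : Mt.PiTemp) :=
    fun _ => rfl
  have hmem_kerEll : ∀ b : ↥(F.reconstruction e).DeltaY,
      (b : ↥(Mt.GtpY.subgroupOf C.Huu)) ∈ W.kerEll ↔
        (((b : ↥(Mt.GtpY.subgroupOf C.Huu)) : ↥C.Huu) : Mt.PiTemp) ∈ K₀ := by
    intro b; rw [hWker, Subgroup.mem_comap]; rfl
  have hj₀N : W.kerEll.subgroupOf (F.reconstruction e).DeltaY ≤ N.comap j₀ := by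
    intro b hb
    rw [Subgroup.mem_comap, hN, Subgroup.mem_subgroupOf, hj₀_val]
    exact (hmem_kerEll b).1 (Subgroup.mem_subgroupOf.1 hb)
  let j : W.DeltaYell →* ↥Mt.DtpY ⧸ N := QuotientGroup.map _ N j₀ hj₀N
  have hj_mk : ∀ b : ↥(F.reconstruction e).DeltaY, j (QuotientGroup.mk b) = QuotientGroup.mk (j₀ b) :=
    fun _ => rfl
  have hj_inj : Function.Injective j := by
    rw [← MonoidHom.ker_eq_bot_iff, eq_bot_iff]
    intro q hq
    induction q using QuotientGroup.induction_on with
    | H b =>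
      rw [MonoidHom.mem_ker, hj_mk, QuotientGroup.eq_one_iff, hN, Subgroup.mem_subgroupOf, hj₀_val] at hq
      rw [Subgroup.mem_bot, QuotientGroup.eq_one_iff, Subgroup.mem_subgroupOf]
      exact (hmem_kerEll b).2 hq
  have hj_surj : Function.Surjective j := by
    intro q
    induction q using QuotientGroup.induction_on with
    | H y =>
      obtain ⟨b', hb', hbb'⟩ := C.exists_mem_Huu_dtpY_thetaToEll_eq hO hYcl hker hl y.2
      let b : ↥(F.reconstruction e).DeltaY :=
        ⟨⟨⟨b', hb'.1⟩, Subgroup.mem_subgroupOf.2 hb'.2.1⟩,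
          (mem_deltaY_reconstruction_iff C μ hC hS h15 L F e _).2 hb'.2.2⟩
      refine ⟨QuotientGroup.mk b, ?_⟩
      rw [hj_mk, QuotientGroup.eq, hN, Subgroup.mem_subgroupOf, Subgroup.coe_mul, Subgroup.coe_inv, hj₀_val]
      change (b'⁻¹ * (y : Mt.PiTemp)) ∈ (Mt.thetaToEll.comp Mt.toTheta).ker
      rw [MonoidHom.mem_ker, map_mul, map_inv, MonoidHom.comp_apply, MonoidHom.comp_apply, hbb', inv_mul_cancel]
  let jE : W.DeltaYell ≃* ↥Mt.DtpY ⧸ N := MulEquiv.ofBijective j ⟨hj_inj, hj_surj⟩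
  have hjE : ∀ y, jE y = j y := fun _ => rfl
  -- ### the action on `Δ^ell_Y(M)` and its pin
  refine ⟨(MulAut.congr jE.symm).toMonoidHom.comp ψ, fun c b b' hbb' => ?_⟩
  have h1 : jE (QuotientGroup.mk b' : W.DeltaYell) = ψ c (jE (QuotientGroup.mk b)) := by
    rw [hbb']
    change jE (jE.symm.symm.trans ((ψ c).trans jE.symm) _) = _
    simp only [MulEquiv.symm_symm, MulEquiv.trans_apply, MulEquiv.apply_symm_apply]
  rw [hjE, hjE, hj_mk, hj_mk, hψ_mk, QuotientGroup.eq, hN, Subgroup.mem_subgroupOf, Subgroup.coe_mul,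
    Subgroup.coe_inv, hφ_val, hj₀_val, hj₀_val] at h1
  change _ ∈ (Mt.thetaToEll.comp Mt.toTheta).ker at h1
  rw [MonoidHom.mem_ker, map_mul, map_inv, inv_mul_eq_one, MonoidHom.comp_apply, MonoidHom.comp_apply] at h1
  exact h1

end ModelFrame

end Literature.IUT.HodgeArakelov

end
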